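import Mathlib
import Summits.NavierStokesRegularity.NavierStokesRegularity.Theses.UnthreadedDoor
import Summits.NavierStokesRegularity.NavierStokesRegularity.Theorems.ImplosionDoorImplosionZoomFading
import Summits.NavierStokesRegularity.NavierStokesRegularity.Theorems.LocalSineTubeDoorLocalPointZoomSlices
import Summits.NavierStokesRegularity.NavierStokesRegularity.Theorems.LocalSineTubeDoorProfileAlignedWindowRigidityAncient
import Literature.Analysis.FluidPDE.TypeIAncientMild
import Literature.Analysis.FluidPDE.MildSolution
import Literature.Analysis.FluidPDE.TaoEnstrophyLocalisation
import HarnessLib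

/-!
# `UnthreadedDoor.UnthreadedZoom` — local point zoom with the radial-vorticity window
  (item stmt-NavierStokesRegularity-27411, support of route UnthreadedDoor)

**Statement (verbatim route decl).** Under the frame hypotheses of the door's `Target` (classical NS
on `[0,T)`, Leray–Hopf, rapidly decaying datum, locally Type I at `(x₀, T)` on
`B(x₀,ρ) × (T−ρ², T)`), all-window mean-square fading of the scale-invariant RADIAL VORTICITY MOMENT,
`∫_{B_R} ⟪(T−t) ω(t, x₀ + √(T−t) y), y⟫² dy → 0` as `t → T⁻` for every `R > 0`, and failure of
backward boundedness at `(x₀, T)` yield `C` and a profile `v` of the Type-I ancient Oseen-mild class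
(Type-I time decay, continuous on the open slab, unit-viscosity Oseen-mild between negative times,
divergence-free slices), backward singular at the apex, whose vorticity is TANGENT TO THE SPHERES
about the origin on every slice: `⟪curl v(s)(y), y⟫ = 0` for all `s < 0` and all `y`.

PROOF (the item's plan; clone of the CLOSED `HalfSpaceWindowDoor.HalfSpaceZoom`, item 25312, and
`ImplosionDoor.ImplosionZoom`, item 25308). The PROVED local point zoom with vorticity slices
(`LocalSineTubeDoorLocalPointZoomSlices.localPointZoomSlices`) gives `C, v, λ_j → 0⁺` with
`(λ_j²/ν) ω(T + λ_j²s/ν, x₀ + λ_j y) → curl v(s, y)` for every `s < 0` and `y`. Fix `s < 0`, put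
`t_j = T + λ_j² s/ν → T⁻` and `c = √(−s/ν)` (`√(T − t_j) = λ_j c`, `T − t_j = (−s)·λ_j²/ν`): the door
functional at time `t_j` and similarity point `y'` is
`F_j(y') = ⟪(−s)·(λ_j²/ν) ω(t_j, x₀ + λ_j (c y')), y'⟫ → g(y') = ⟪(−s) curl v(s)(c y'), y'⟫`,
continuous in `y'` (slices of the class are smooth by joint analyticity), while the door hypothesis
along `t_j` says `∫_{B_R} F_j² → 0`, hence both one-signed parts fade (`(max(F,0))², (min(F,0))² ≤ F²`).
The two fading lemmas (`ZoomFading.nonpos_of_fading_posPart` / `nonneg_of_fading_negPart`: Fatou +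
continuity) give `g ≤ 0` and `g ≥ 0`, i.e. `g = 0`; reading it at `y' = c⁻¹ y` gives
`⟪curl v(s)(y), y⟫ = 0`.

HONEST FRAMING: a compactness/bookkeeping lemma about a HYPOTHETICAL locally Type-I blow-up
(support item of a DRAFT door route); nothing here bears on `PoloidalLiouville` (stmt-1222), on the
door's `Target`, or on Navier–Stokes regularity — all OPEN.
-/

noncomputable section

set_option linter.dupNamespace false

namespace Summit.NavierStokesRegularity.NavierStokesRegularity.Theorems

open MeasureTheory Set Filter Topology Metric Function
open Literature.Analysis Literature.Analysis.FluidPDE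
open scoped RealInnerProductSpace InnerProductSpace ENNReal

namespace ZoomFading

/-- Mean-square fading of `F_j` on a ball implies mean-square fading of its positive part there
(`(max(F,0))² ≤ F²`). [folklore] -/
theorem fading_posPart_of_fading_sq {F : ℕ → EuclideanSpace ℝ (Fin 3) → ℝ} {R : ℝ}
    (h : Tendsto (fun j => ∫⁻ y in ball (0 : EuclideanSpace ℝ (Fin 3)) R,
      ENNReal.ofReal ((F j y) ^ 2)) atTop (𝓝 0)) :
    Tendsto (fun j => ∫⁻ y in ball (0 : EuclideanSpace ℝ (Fin 3)) R,
      ENNReal.ofReal ((max (F j y) 0) ^ 2)) atTop (𝓝 0) := by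
  refine tendsto_of_tendsto_of_tendsto_of_le_of_le tendsto_const_nhds h (fun _ => bot_le)
    fun j => lintegral_mono fun y => ENNReal.ofReal_le_ofReal ?_
  have h1 : |max (F j y) 0| ≤ |F j y| := by
    rw [abs_of_nonneg (le_max_right _ _)]
    exact max_le (le_abs_self _) (abs_nonneg _)
  calc (max (F j y) 0) ^ 2 = |max (F j y) 0| ^ 2 := (sq_abs _).symm
    _ ≤ |F j y| ^ 2 := pow_le_pow_left₀ (abs_nonneg _) h1 2
    _ = (F j y) ^ 2 := sq_abs _

/-- Mean-square fading of `F_j` on a ball implies mean-square fading of its negative part there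
(`(min(F,0))² ≤ F²`). [folklore] -/
theorem fading_negPart_of_fading_sq {F : ℕ → EuclideanSpace ℝ (Fin 3) → ℝ} {R : ℝ}
    (h : Tendsto (fun j => ∫⁻ y in ball (0 : EuclideanSpace ℝ (Fin 3)) R,
      ENNReal.ofReal ((F j y) ^ 2)) atTop (𝓝 0)) :
    Tendsto (fun j => ∫⁻ y in ball (0 : EuclideanSpace ℝ (Fin 3)) R,
      ENNReal.ofReal ((min (F j y) 0) ^ 2)) atTop (𝓝 0) := by
  refine tendsto_of_tendsto_of_tendsto_of_le_of_le tendsto_const_nhds h (fun _ => bot_le)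
    fun j => lintegral_mono fun y => ENNReal.ofReal_le_ofReal ?_
  have h1 : |min (F j y) 0| ≤ |F j y| := by
    rw [abs_of_nonpos (min_le_right _ _)]
    rcases le_total (F j y) 0 with h0 | h0
    · rw [min_eq_left h0, abs_of_nonpos h0]
    · rw [min_eq_right h0, neg_zero]; exact abs_nonneg _
  calc (min (F j y) 0) ^ 2 = |min (F j y) 0| ^ 2 := (sq_abs _).symm
    _ ≤ |F j y| ^ 2 := pow_le_pow_left₀ (abs_nonneg _) h1 2
    _ = (F j y) ^ 2 := sq_abs _

/-- **Mean-square fading forces a vanishing pointwise limit**: measurable `F_j → g` pointwise with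
`g` continuous and `∫_{B_R} F_j² → 0` for every `R > 0` give `g ≡ 0` (both one-signed fading
lemmas). [folklore] -/
theorem eq_zero_of_fading_sq {F : ℕ → EuclideanSpace ℝ (Fin 3) → ℝ}
    {g : EuclideanSpace ℝ (Fin 3) → ℝ} (hg : Continuous g)
    (hF : ∀ j, Measurable (F j))
    (hlim : ∀ y, Tendsto (fun j => F j y) atTop (𝓝 (g y)))
    (hfade : ∀ R : ℝ, 0 < R → Tendsto (fun j => ∫⁻ y in ball (0 : EuclideanSpace ℝ (Fin 3)) R,
      ENNReal.ofReal ((F j y) ^ 2)) atTop (𝓝 0)) :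
    ∀ y, g y = 0 := fun y =>
  le_antisymm
    (nonpos_of_fading_posPart hg hF hlim (fun R hR => fading_posPart_of_fading_sq (hfade R hR)) y)
    (nonneg_of_fading_negPart hg hF hlim (fun R hR => fading_negPart_of_fading_sq (hfade R hR)) y)

end ZoomFading

open LocalSineTubeDoorLocalPointZoomSlices ZoomFading
  Summit.NavierStokesRegularity.NavierStokesRegularity.Theorems.LocalSineTubeDoorProfileAlignedWindowRigidityAncient in
/-- **Item stmt-NavierStokesRegularity-27411** (`UnthreadedDoor.UnthreadedZoom`): at a locally
Type-I, not backward bounded point whose scale-invariant radial vorticity moment fades in mean square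
on every window, the local point zoom limit is a Type-I ancient Oseen-mild profile, backward singular
at the apex, whose vorticity is tangent to the spheres about the origin on every slice,
`⟪curl v(s)(y), y⟫ = 0`.
[cite: SereginSverak2009, §3; KochNadirashviliSereginSverak2009, §5–6; AlbrittonBarker2019, §2] -/
theorem unthreadedDoor_unthreadedZoom_proof :
    Summit.NavierStokesRegularity.NavierStokesRegularity.Theses.UnthreadedDoor.UnthreadedZoom := by
  unfold Summit.NavierStokesRegularity.NavierStokesRegularity.Theses.UnthreadedDoor.UnthreadedZoom
  intro ν T hν hT u p hsol hLH hdec x₀ ρ M hρ hM hfade hnotbd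
  obtain ⟨C, v, lam, hlam, hlam0, hclass, hsing, hzoom⟩ :=
    localPointZoomSlices ν T hν hT u p hsol hLH hdec x₀ ρ M hρ hM hnotbd
  refine ⟨C, v, hclass, hsing, fun s hs y => ?_⟩
  obtain ⟨hrate, hcont, hmild, hdiv⟩ := hclass
  -- the class is the tree's `IsTypeIAncientMild` (joint smoothness from joint analyticity),
  -- so the vorticity slice `curl v(s)` is continuous
  have hA : IsTypeIAncientMild C v := by
    refine ⟨(analyticOnNhd_uncurry hcont (bdd_of_hasTypeITimeDecay hrate) hmild).contDiffOn_of_completeSpace,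
      fun t ht => hdiv t ht, fun s t hst ht x => ?_, hrate⟩
    rw [heatFlow_of_pos _ (sub_pos.2 hst)]
    exact hmild s t hst ht x
  have hcurlv : Continuous (curl (v s)) := by
    have h1 : ContDiff ℝ 1 (v s) := (hA.contDiff_slice hs).of_le (by exact_mod_cast le_top)
    rw [curl_eq_curlCLM_comp]
    exact curlCLM.continuous.comp (h1.continuous_fderiv one_ne_zero)
  -- the similarity factor `c = √(−s/ν)` and the zoom times `t_j = T + λ_j² s/ν → T⁻`
  have hsν : 0 < -s / ν := div_pos (neg_pos.2 hs) hν
  set c : ℝ := Real.sqrt (-s / ν) with hcdef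
  have hc : 0 < c := Real.sqrt_pos.2 hsν
  set tj : ℕ → ℝ := fun j => T + lam j ^ 2 * s / ν with htjdef
  have htjT : ∀ j, tj j < T := fun j => by
    have : lam j ^ 2 * s / ν < 0 :=
      div_neg_of_neg_of_pos (mul_neg_of_pos_of_neg (pow_pos (hlam j) 2) hs) hν
    simp only [htjdef]; linarith
  have htj_sub : ∀ j, T - tj j = lam j ^ 2 * (-s / ν) := fun j => by
    simp only [htjdef]; ring
  have hsqrt : ∀ j, Real.sqrt (T - tj j) = lam j * c := fun j => by
    rw [htj_sub, Real.sqrt_mul (sq_nonneg _), Real.sqrt_sq (hlam j).le]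
  have htj_nhds : Tendsto tj atTop (𝓝 T) := by
    have h1 : Tendsto (fun j => T + lam j ^ 2 * s / ν) atTop (𝓝 (T + 0 ^ 2 * s / ν)) :=
      (((hlam0.pow 2).mul_const s).div_const ν).const_add T
    simpa using h1
  have htj_tend : Tendsto tj atTop (𝓝[<] T) :=
    tendsto_nhdsWithin_iff.2 ⟨htj_nhds, Eventually.of_forall htjT⟩
  -- eventually the zoom times are physical: `t_j ∈ [0, T)`
  obtain ⟨N, hN⟩ : ∃ N : ℕ, ∀ j ≥ N, 0 ≤ tj j := by
    obtain ⟨N, hN⟩ := eventually_atTop.1 (htj_nhds.eventually (lt_mem_nhds hT))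
    exact ⟨N, fun j hj => (hN j hj).le⟩
  have htjI : ∀ j, tj (j + N) ∈ Ico 0 T := fun j =>
    ⟨hN _ (Nat.le_add_left N j), htjT _⟩
  -- the door functionals along the (shifted) zoom times and their pointwise limit
  set F : ℕ → EuclideanSpace ℝ (Fin 3) → ℝ := fun j y' =>
    ⟪(T - tj (j + N)) • curl (u (tj (j + N))) (x₀ + Real.sqrt (T - tj (j + N)) • y'), y'⟫_ℝ
    with hFdef
  set g : EuclideanSpace ℝ (Fin 3) → ℝ := fun y' => ⟪(-s) • curl (v s) (c • y'), y'⟫_ℝ with hgdef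
  have hg : Continuous g := by
    have h1 : Continuous fun y' : EuclideanSpace ℝ (Fin 3) => c • y' := continuous_const_smul c
    have h2 : Continuous fun y' : EuclideanSpace ℝ (Fin 3) => curl (v s) (c • y') := hcurlv.comp h1
    exact (h2.const_smul (-s)).inner continuous_id
  have hF : ∀ j, Measurable (F j) := by
    intro j
    have huC : ContDiff ℝ 1 (u (tj (j + N))) :=
      (hsol.contDiff_velocity (htjI j)).of_le (by exact_mod_cast le_top)
    have huc : Continuous (curl (u (tj (j + N)))) := by
      rw [curl_eq_curlCLM_comp]
      exact curlCLM.continuous.comp (huC.continuous_fderiv one_ne_zero)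
    have h1 : Continuous fun y' : EuclideanSpace ℝ (Fin 3) =>
        x₀ + Real.sqrt (T - tj (j + N)) • y' :=
      continuous_const.add (continuous_const_smul _)
    exact (((huc.comp h1).const_smul (T - tj (j + N))).inner continuous_id).measurable
  have hlimF : ∀ y', Tendsto (fun j => F j y') atTop (𝓝 (g y')) := by
    intro y'
    -- the vorticity zoom at the point `c • y'`, shifted by `N`, scaled by `−s`, paired with `y'`
    have hz := ((hzoom s hs (c • y')).comp (tendsto_add_atTop_nat N)).const_smul (-s)
    have hz' := hz.inner (𝕜 := ℝ) (tendsto_const_nhds (x := y'))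
    refine hz'.congr fun j => ?_
    simp only [hFdef, Function.comp_apply]
    congr 1
    rw [hsqrt, smul_smul, mul_smul (lam (j + N)) c y', htj_sub]
    congr 1
    field_simp
  have hfadeF : ∀ R : ℝ, 0 < R → Tendsto (fun j => ∫⁻ y' in ball (0 : EuclideanSpace ℝ (Fin 3)) R,
      ENNReal.ofReal ((F j y') ^ 2)) atTop (𝓝 0) := by
    intro R hR
    exact ((hfade R hR).comp htj_tend).comp (tendsto_add_atTop_nat N)
  -- the two fading lemmas: `g = 0`; read it at `y' = c⁻¹ • y`
  have hgy := eq_zero_of_fading_sq hg hF hlimF hfadeF (c⁻¹ • y)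
  have hcy : c • c⁻¹ • y = y := by rw [smul_smul, mul_inv_cancel₀ hc.ne', one_smul]
  simp only [hgdef, hcy, real_inner_smul_left, real_inner_smul_right] at hgy
  have hsc : (-s) * c⁻¹ ≠ 0 := mul_ne_zero (neg_pos.2 hs).ne' (inv_ne_zero hc.ne')
  have e : (-s) * c⁻¹ * ⟪curl (v s) y, y⟫_ℝ = 0 := by
    rw [mul_assoc]; exact hgy
  exact (mul_eq_zero.1 e).resolve_left hsc

end Summit.NavierStokesRegularity.NavierStokesRegularity.Theorems

end
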